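import Summits.CriticalPhenomena.PercolationContinuityZ3.Theorems.FK.ClusterVolumeDecayRate
import Summits.CriticalPhenomena.PercolationContinuityZ3.Theorems.FK.VolumeTailBelowPcOne
import HarnessLib

/-!
# FK-continuity cell, FO-10a: the volume decay rate `ζ^b(p,q)` of `φ^b_{p,q}` is POSITIVE for `p < p_c(ℤ^d) = p_c(1)`
# (Grimmett 2006, Thm. (5.55), `ζ`-half, in rate form: `ClusterVolumeDecayRate` + `VolumeTailBelowPcOne`)

Registered R123 (cell INBOX l.7797, 2026-08-26); registry row FO-10a-g344z; label ZP-A (coordinator fk-4 g237).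
Cell `fk-continuity` (bschramm), row FO-10a (domain-Markov + comparison layer over FO-06); support file for the
FK-continuity transplant (`--supports stmt-CriticalPhenomena-4575`); builds on p205010 (kernel theorem, internal
audit signed; external expert review pending). Pure proofs; no definitions, no named facts, no sorries; `d ≥ 2`, both
boundary conditions `b`, `0 < p < p_c(ℤ^d)`, `q ≥ 1`. UNCONDITIONAL structure; it decides nothing for
`p_c(1) ≤ p < p_c(q)` (Conjecture (5.54)), nor about FH / TP_FK / `p_c(q)`.

* **`IsBoxLimit.exists_volumeDecayRate_pos_of_lt_criticalProb`** — for a box limit `P` (`IsBoxLimit d b p q P`, `d ≥ 2`,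
  `0 < p < p_c(ℤ^d)`, `q ≥ 1`): the volume decay rate of `ClusterVolumeDecayRate.lean` is positive, i.e.
  `∃ ζ > 0, -n⁻¹ log P(|C_0| = n) → ζ ∧ ∀ n ≥ 1, P(|C_0| = n) ≤ (q(1-p)/p)(2n+1)^d e^{-nζ}`: the limit exists
  (`IsBoxLimit.exists_volumeDecayRate`) and is eventually bounded below by `c - (log K)/n → c > 0`
  (`IsBoxLimit.le_neg_log_real_ncard_div_of_lt_criticalProb`, the probabilities being positive by
  `IsBoxLimit.real_ncard_inter_lexMin_pos`);
* **`exists_volumeDecayRate_pos_rcLimit_of_lt_criticalProb`** — the same for `φ^b_{p,q} = rcLimit d b p q`.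

## References

* G. Grimmett, *The Random-Cluster Model*, Springer 2006 (`book:grimmett2006-random-cluster-model`): §5.4 (5.42)–(5.43),
  Thm. (5.47), Cor. (5.51), Thm. (5.55), Conj. (5.54) [PDF pp. 110–112]. [Grimmett2006]
-/

noncomputable section

open MeasureTheory Set Filter
open scoped Topology ENNReal

namespace Summit.CriticalPhenomena.PercolationContinuityZ3.Theorems.FK

open Literature.Probability.Percolation Literature.Probability.LatticeModels

variable {d : ℕ} {b : Bool} {p q : ℝ} {P : Measure (BondConfig (Site d))}

/-- **Grimmett 2006, Thm. (5.55), `ζ`-half: `ζ^b(p,q) > 0` for `0 < p < p_c(1)`** — for every box limit `P` of the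
random-cluster model on `ℤ^d` (`d ≥ 2`, `q ≥ 1`, either `b`) with `0 < p < p_c(ℤ^d)`:
`∃ ζ > 0, -n⁻¹ log P(|C_0| = n) → ζ ∧ ∀ n ≥ 1, P(|C_0| = n) ≤ (q(1-p)/p)(2n+1)^d e^{-nζ}`.
[cite: Grimmett2006, Thm. (5.55), (5.42)–(5.43), Thm. (5.47)/Cor. (5.51)] -/
theorem IsBoxLimit.exists_volumeDecayRate_pos_of_lt_criticalProb (hd : 2 ≤ d) (hP : IsBoxLimit d b p q P)
    (hp : p ∈ Set.Ioo (0 : ℝ) 1) (hq : 1 ≤ q) (hpc : p < criticalProb (zdGraph d) (0 : Site d)) :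
    ∃ ζ : ℝ, 0 < ζ ∧
      Tendsto (fun n : ℕ => -(1 / (n : ℝ)) * Real.log (P.real {ω : BondConfig (Site d) | (openCluster ω 0).ncard = n}))
        atTop (𝓝 ζ) ∧
      ∀ n : ℕ, 1 ≤ n → P.real {ω : BondConfig (Site d) | (openCluster ω 0).ncard = n} ≤
        q * (1 - p) / p * ((2 * n + 1) ^ d : ℕ) * Real.exp (-(n * ζ)) := by
  haveI := hP.isProbabilityMeasure
  have hd0 : 0 < d := by omega
  obtain ⟨ζ, -, hζ, hbound⟩ := hP.exists_volumeDecayRate hd0 hp hq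
  obtain ⟨c, hc, K, hK, hlow⟩ := hP.le_neg_log_real_ncard_div_of_lt_criticalProb hd ⟨hp.1, hp.2.le⟩ hq hpc
  refine ⟨ζ, ?_, hζ, hbound⟩
  -- the probabilities are positive, so the lower bound applies for every `n ≥ 1`
  have hpos : ∀ n : ℕ, 1 ≤ n → 0 < P.real {ω : BondConfig (Site d) | (openCluster ω 0).ncard = n} := by
    intro n hn
    refine (hP.real_ncard_inter_lexMin_pos hd0 hp hq hn).trans_le (measureReal_mono Set.inter_subset_left)
  have hlim : Tendsto (fun n : ℕ => c - Real.log K / n) atTop (𝓝 (c - 0)) :=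
    tendsto_const_nhds.sub (tendsto_const_div_atTop_nhds_zero_nat _)
  rw [sub_zero] at hlim
  have hle : c ≤ ζ := by
    refine le_of_tendsto_of_tendsto' (hlim.comp (tendsto_add_atTop_nat 1)) (hζ.comp (tendsto_add_atTop_nat 1))
      fun n => ?_
    simp only [Function.comp]
    exact hlow (n + 1) (by omega) (hpos (n + 1) (by omega))
  exact hc.trans_le hle

/-- **`ζ^b(p,q) > 0` for `φ^b_{p,q} = rcLimit d b p q`, `0 < p < p_c(ℤ^d)`** (`d ≥ 2`, `q ≥ 1`, either `b`): Grimmett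
2006, Thm. (5.55), `ζ`-half. Nothing is claimed for `p_c(1) ≤ p < p_c(q)` (Conjecture (5.54)).
[cite: Grimmett2006, Thm. (5.55), Conj. (5.54)] -/
theorem exists_volumeDecayRate_pos_rcLimit_of_lt_criticalProb (hd : 2 ≤ d) (b : Bool) {p q : ℝ}
    (hp : p ∈ Set.Ioo (0 : ℝ) 1) (hq : 1 ≤ q) (hpc : p < criticalProb (zdGraph d) (0 : Site d)) :
    ∃ ζ : ℝ, 0 < ζ ∧
      Tendsto (fun n : ℕ => -(1 / (n : ℝ)) *
          Real.log ((rcLimit d b p q).real {ω : BondConfig (Site d) | (openCluster ω 0).ncard = n})) atTop (𝓝 ζ) ∧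
      ∀ n : ℕ, 1 ≤ n → (rcLimit d b p q).real {ω : BondConfig (Site d) | (openCluster ω 0).ncard = n} ≤
        q * (1 - p) / p * ((2 * n + 1) ^ d : ℕ) * Real.exp (-(n * ζ)) :=
  (isBoxLimit_rcLimit b ⟨hp.1.le, hp.2.le⟩ hq).exists_volumeDecayRate_pos_of_lt_criticalProb hd hp hq hpc

end Summit.CriticalPhenomena.PercolationContinuityZ3.Theorems.FK

end
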